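import Summits.BirchSwinnertonDyer.BirchSwinnertonDyer.Theorems.ThetaPartnerAtTwoSignedControlAtTwoRelaxedKummerCountAllLevels
import Summits.BirchSwinnertonDyer.BirchSwinnertonDyer.Theorems.QuadraticBranchSignedControlEtaLayerClassical
import HarnessLib

/-!
# Transport of level-`p^k` classes over a Galois layer `L/K` into `H¹(Gal(K̄/L), E[p^∞]) ≤ H¹(Γ_K-subgroup)`, with the
# PLACE-WISE dictionary «Kummer at every `w ∣ u` of `L`» ⟺ «classical at `u` for every `Γ_K`-conjugate»
# (crux ♭T≤ stmt-BirchSwinnertonDyer-23042, line `sigmacongruence`, stub R1 `stub_relaxedImageCount`, brick (b) of the relaxed count road)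

Route `UniversalToricDescent`, lead prover `bsd-wall-utd-p1` g18. THEOREMS ONLY (no definition, no named fact, no `sorry`);
`--supports stmt-BirchSwinnertonDyer-23042`. BSD is not proved by any of this.

Setting: `K ⊆ L` number fields, `L/K` Galois, `U ≤ galRange L` a normal subgroup of `Γ_K` with `res⁻¹(U)` ALL of `Γ_L` (on the route:
`L = K_n`, `U = Γ_n = κ.layerSubgroup n`, the SEAM `galRange K_n = Γ_n`), `E = W/K` elliptic, `p` prime, `k : ℕ`. The TP2/RTT INPUTS seat's
transport (…RelaxedKummerCountAllLevels §1–§2) `Φ = subgroupH1Iso ∘ res_{⊤ → res⁻¹U} ∘ (⊤ ↪ Γ_L)_* ∘ (E_L[p^k] ↪ E_L[p^∞])_* :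
H¹(Γ_L, E_L[p^k]) → H¹(U, E[p^∞])` is packaged here as ONE additive map with the three properties the relaxed count road consumes:

* `exists_transport` — **∃ `Φ : H¹(Γ_L, E_L[p^k]) →+ H¹(U, E[p^∞])`** with (i) `p^k • Φ x = 0`; (ii) `Φ` is INJECTIVE when
  `E_L(L)[p^∞]^{Γ_L} = 0` (kernel of `(E_L[p^k] ↪ E_L[p^∞])_*` bounded by the fixed points, …LevelZero); (iii) for EVERY finite place `u`
  of `K` and every `x`: **`x` satisfies the local Kummer condition at every place `w ∣ u` of `L` IFF `conj_σ (Φ x)` satisfies the classical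
  local condition `localKerOver p U K_u` for every `σ ∈ Γ_K`** — `→` is the INPUTS seat's `conjH1_subgroupH1Iso_mem_localKerOver_adicCompletion`,
  `←` is the `K → L` package of cell `bsd-potss` (`EtaLayer.exists_package_adicCompletion_of_embedding` + the iff
  `subgroupH1Iso_mem_localKerOverOfEmb_iff`) followed by the same-field dictionary run backwards (`localResOverOfEmb_resOfLe` + injectivity of
  `res_{⊤→res⁻¹U}` on the local subgroups, `resH1Hom_subgroupIncl_mem_localKerOver_top_iff`, and the level-`p^k`-to-`p^∞` local kernel as an IFF,
  `resH1Hom_inclusion_mem_selmerLocalKerPrimary_iff` §1).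

References: [GreenbergLNM1716] §2 (pp. 62–63, local conditions at the primes of `M` above a prime of `F`), §3 Lemma 3.1;
[SerreGaloisCohomology1997] I.§2.4, II.§1.1; [NeukirchANT1999] II.§8; [Mazur1972] §6.
-/

set_option linter.dupNamespace false
set_option autoImplicit false

noncomputable section
open scoped Classical
open CategoryTheory Field NumberField IsDedekindDomain Function
open Literature.NumberTheory.EllipticCurves Literature.NumberTheory.EllipticCurves.GreenbergSelmer
open Literature.NumberTheory.GaloisRepresentations
open Literature.NumberTheory.GaloisCohomology
open scoped ContRepresentation
open scoped NumberField.LiesOver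

namespace Summit.BirchSwinnertonDyer.BirchSwinnertonDyer.Theorems.UniversalToricDescentRelaxedLayerTransport

open Summit.BirchSwinnertonDyer.Rank1Residual.X11b.KummerPT Summit.BirchSwinnertonDyer.Rank1Residual.X11b.LocBridge
  Summit.BirchSwinnertonDyer.Rank1Residual.X11b.Levels Summit.BirchSwinnertonDyer.Rank1Residual.X11b.AcSelmer
  Summit.BirchSwinnertonDyer.BirchSwinnertonDyer.Theorems.SignedEC.RelaxedKummerCount
  Summit.BirchSwinnertonDyer.Rank1Residual.Additive Summit.BirchSwinnertonDyer.Rank1Residual.Additive.LocalTransport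
  Summit.BirchSwinnertonDyer.Rank1Residual.Additive.BaseChange
  Summit.BirchSwinnertonDyer.BirchSwinnertonDyer.Theorems.EtaLayer

/-! ## §1 The level-`p^M` local kernel versus the `p^∞` local kernel: an IFF -/

section SameField

variable {L : Type} [Field L] [NumberField L] (W' : WeierstrassCurve L) (p : ℕ)

omit [NumberField L] in
/-- **`y` dies in `H¹(Γ_E, E(L̄_E))` at level `p^M` IFF its image in `H¹(L, E[p^∞])` does** (both maps to `H¹(Γ_E, E(L̄_E))` are
induced by the same compatible pair; …LevelZero has `→`). [cite: GreenbergLNM1716, §2 (p. 63)] -/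
theorem resH1Hom_inclusion_mem_selmerLocalKerPrimary_iff (M : ℕ) (E : Type) [Field E] [Algebra L E]
    (y : W'.galH1Torsion ((p ^ M : ℕ) : ℤ)) :
    resH1Hom (ContinuousMonoidHom.id (Field.absoluteGaloisGroup L))
        (AddSubgroup.inclusion
          (Literature.Barriers.BirchSwinnertonDyer.geomTorsion_pow_le_geomPrimaryTorsion W' p M))
        (fun _ _ ↦ rfl) y ∈ WeierstrassCurve.selmerLocalKerPrimary W' E p ↔
      y ∈ WeierstrassCurve.selmerLocalKer W' E ((p ^ M : ℕ) : ℤ) := by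
  refine ⟨fun h ↦ ?_, fun h ↦ resH1Hom_inclusion_mem_selmerLocalKerPrimary W' p M E h⟩
  rw [WeierstrassCurve.mem_selmerLocalKerPrimary_iff, ← AddMonoidHom.comp_apply, resH1Hom_comp] at h
  unfold WeierstrassCurve.selmerLocalKer
  rw [resKer_eq_ker, AddMonoidHom.mem_ker, ← h]
  exact (DFunLike.congr_fun (resH1Hom_congr (by ext; rfl) (by ext; rfl) _ _) y).symm

end SameField

/-! ## §2 The transport and its place-wise dictionary -/

section Transport

variable {K : Type} [Field K] [NumberField K] (W : WeierstrassCurve K) [W.IsElliptic] (p k : ℕ) [Fact p.Prime]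
  (L : Type) [Field L] [NumberField L] [Algebra K L] [IsGalois K L]
  {U : Subgroup (Field.absoluteGaloisGroup K)} [U.Normal] (hU : U ≤ galRange (K := K) L)
  (hH : ∀ τ : Field.absoluteGaloisGroup L, τ ∈ comapResGal L U)

include hU hH in
/-- **The transport `Φ : H¹(Γ_L, E_L[p^k]) →+ H¹(U, E[p^∞])` and its three properties** (module docstring): `p^k`-torsion values,
injectivity when `E_L[p^∞]^{Γ_L} = 0`, and the place-wise dictionary «Kummer at every `w ∣ u`» ⟺ «`conj_σ (Φ x)` classical at `u`
for all `σ`» at every finite place `u` of `K`. [cite: GreenbergLNM1716, §2 (pp. 62–63), §3 Lemma 3.1]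
[cite: SerreGaloisCohomology1997, I.§2.4, II.§1.1] [cite: NeukirchANT1999, Ch. II §8] -/
theorem exists_transport :
    ∃ Φ : galoisCohomology ((W.baseChange L).torsionGaloisModule ((p ^ k : ℕ) : ℤ)) 1 →+ W.subgroupH1 p U,
      (∀ x, p ^ k • Φ x = 0) ∧
      ((∀ m : (W.baseChange L).geomPrimaryTorsion p, (∀ σ : Field.absoluteGaloisGroup L, σ • m = m) → m = 0) →
        Function.Injective Φ) ∧
      ∀ (u : HeightOneSpectrum (𝓞 K)) (x : galoisCohomology ((W.baseChange L).torsionGaloisModule ((p ^ k : ℕ) : ℤ)) 1),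
        (∀ w : HeightOneSpectrum (𝓞 L), w.asIdeal.LiesOver u.asIdeal →
          galoisCohomology.res ((W.baseChange L).torsionGaloisModule ((p ^ k : ℕ) : ℤ)) (w.adicCompletion L) 1 x ∈
            (W.baseChange L).kummerLocalConditionAt ((p ^ k : ℕ) : ℤ) (w.adicCompletion L)) ↔
        ∀ σ : Field.absoluteGaloisGroup K, W.conjH1 p U σ (Φ x) ∈ W.localKerOver p U (u.adicCompletion K) := by
  classical
  haveI : PerfectField K := PerfectField.ofCharZero
  haveI : PerfectField L := PerfectField.ofCharZero
  set W' := W.baseChange L with hW'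
  haveI : NeZero (p ^ k) := ⟨pow_ne_zero k (Fact.out : p.Prime).ne_zero⟩
  have hle : comapResGal L U ≤ ⊤ := le_top
  have hge : (⊤ : Subgroup (Field.absoluteGaloisGroup L)) ≤ comapResGal L U := fun σ _ ↦ hH σ
  let ι₁ : galoisCohomology (W'.torsionGaloisModule ((p ^ k : ℕ) : ℤ)) 1 →+ W'.galH1Primary p :=
    resH1Hom (ContinuousMonoidHom.id (Field.absoluteGaloisGroup L))
      (AddSubgroup.inclusion
        (Literature.Barriers.BirchSwinnertonDyer.geomTorsion_pow_le_geomPrimaryTorsion W' p k))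
      (fun _ _ ↦ rfl)
  let ι₂ : W'.galH1Primary p →+ W'.subgroupH1 p ⊤ :=
    resH1Hom (Literature.NumberTheory.EllipticCurves.subgroupIncl (⊤ : Subgroup (Field.absoluteGaloisGroup L)))
      (AddMonoidHom.id (W'.geomPrimaryTorsion p)) (fun _ _ ↦ rfl)
  let ι₃ : W'.subgroupH1 p ⊤ →+ W'.subgroupH1 p (comapResGal L U) := W'.resOfLe p hle
  let Ψ := subgroupH1Iso L W p hU
  let Φ : galoisCohomology (W'.torsionGaloisModule ((p ^ k : ℕ) : ℤ)) 1 →+ W.subgroupH1 p U :=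
    Ψ.toAddMonoidHom.comp (ι₃.comp (ι₂.comp ι₁))
  have hΦ : ∀ x, Φ x = Ψ (ι₃ (ι₂ (ι₁ x))) := fun _ ↦ rfl
  have hι₂ : Function.Injective ι₂ := (bijective_resH1Hom_subgroupIncl _ ⊤ Subgroup.mem_top).1
  have hι₃ : Function.Injective ι₃ := resOfLe_injective_of_ge (W'.geomPrimaryTorsion p) hle hge
  refine ⟨Φ, fun x ↦ ?_, fun hfix ↦ ?_, fun u x ↦ ?_⟩
  · -- (i) `p^k`-torsion
    have hx0 : p ^ k • x = 0 :=
      nsmul_continuousCohomology_one_eq_zero _ (p ^ k)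
        (fun T : W'.geomTorsion ((p ^ k : ℕ) : ℤ) ↦ AddSubgroup.torsionBy.nsmul T) x
    rw [← map_nsmul, hx0, map_zero]
  · -- (ii) injectivity
    have hι₁ : Function.Injective ι₁ := by
      obtain ⟨hkerfin, hkerle⟩ := finite_ker_resH1Hom_inclusion_and_natCard_le W' p k
      haveI : Finite ι₁.ker := hkerfin
      have hfix1 : Nat.card {m : W'.geomPrimaryTorsion p | ∀ σ : Field.absoluteGaloisGroup L, σ • m = m} = 1 := by
        rw [Nat.card_eq_one_iff_unique]
        refine ⟨⟨fun a b ↦ Subtype.ext ((hfix a.1 a.2).trans (hfix b.1 b.2).symm)⟩, ⟨⟨0, fun σ ↦ smul_zero σ⟩⟩⟩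
      have hker1 : Nat.card ι₁.ker ≤ 1 := by
        have h := hkerle
        rw [hfix1] at h
        exact h
      rw [injective_iff_map_eq_zero]
      intro x hx
      have hmem : x ∈ ι₁.ker := (AddMonoidHom.mem_ker).mpr hx
      have hsub : Subsingleton ι₁.ker := Finite.card_le_one_iff_subsingleton.mp hker1
      have := hsub.elim ⟨x, hmem⟩ ⟨0, ι₁.ker.zero_mem⟩
      exact congrArg Subtype.val this
    intro x y hxy
    rw [hΦ, hΦ] at hxy
    exact hι₁ (hι₂ (hι₃ (Ψ.injective hxy)))
  · -- (iii) the place-wise dictionary at `u`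
    -- same-field dictionary at a place `w` of `L`: Kummer at `w` ⟺ `ι₃ ι₂ ι₁ x ∈ localKerOver (res⁻¹U) L_w`
    have hsame : ∀ w : HeightOneSpectrum (𝓞 L),
        galoisCohomology.res (W'.torsionGaloisModule ((p ^ k : ℕ) : ℤ)) (w.adicCompletion L) 1 x ∈
            W'.kummerLocalConditionAt ((p ^ k : ℕ) : ℤ) (w.adicCompletion L) ↔
          ι₃ (ι₂ (ι₁ x)) ∈ W'.localKerOver p (comapResGal L U) (w.adicCompletion L) := by
      intro w
      have h1 : galoisCohomology.res (W'.torsionGaloisModule ((p ^ k : ℕ) : ℤ)) (w.adicCompletion L) 1 x ∈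
            W'.kummerLocalConditionAt ((p ^ k : ℕ) : ℤ) (w.adicCompletion L) ↔
          x ∈ WeierstrassCurve.selmerLocalKer W' (w.adicCompletion L) ((p ^ k : ℕ) : ℤ) := by
        rw [← W'.comap_res_kummerLocalConditionAt ((p ^ k : ℕ) : ℤ) (w.adicCompletion L)]
        exact Iff.rfl
      have h2 : ι₁ x ∈ WeierstrassCurve.selmerLocalKerPrimary W' (w.adicCompletion L) p ↔
          x ∈ WeierstrassCurve.selmerLocalKer W' (w.adicCompletion L) ((p ^ k : ℕ) : ℤ) :=
        resH1Hom_inclusion_mem_selmerLocalKerPrimary_iff W' p k (w.adicCompletion L) x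
      have h3 : ι₂ (ι₁ x) ∈ W'.localKerOver p ⊤ (w.adicCompletion L) ↔
          ι₁ x ∈ WeierstrassCurve.selmerLocalKerPrimary W' (w.adicCompletion L) p :=
        WeierstrassCurve.resH1Hom_subgroupIncl_mem_localKerOver_top_iff W' p (ι₁ x)
      refine h1.trans (h2.symm.trans (h3.symm.trans ?_))
      constructor
      · intro h; exact W'.resOfLe_mem_localKerOver p _ hle h
      · intro h
        rw [WeierstrassCurve.localKerOver_eq_ofEmb, WeierstrassCurve.localKerOverOfEmb, AddMonoidHom.mem_ker] at h ⊢
        have e := W'.localResOverOfEmb_resOfLe p (closureEmb (K := L) (w.adicCompletion L)) hle (ι₂ (ι₁ x))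
        change W'.localResOverOfEmb p (comapResGal L U) _ (ι₃ (ι₂ (ι₁ x))) = _ at e
        rw [e] at h
        have hinj := resOfLe_injective_of_ge (localPoints W' (w.adicCompletion L))
          (Subgroup.comap_mono hle :
            localSubgroupOfEmb (comapResGal L U) (closureEmb (K := L) (w.adicCompletion L)) ≤
              localSubgroupOfEmb ⊤ (closureEmb (K := L) (w.adicCompletion L)))
          (Subgroup.comap_mono hge)
        exact hinj (h.trans (map_zero _).symm)
    -- conjugation by `Γ_L` is trivial on `H¹(res⁻¹U, ·)` since `res⁻¹U` is everything
    have hconj : ∀ τ : Field.absoluteGaloisGroup L, W'.conjH1 p (comapResGal L U) τ (ι₃ (ι₂ (ι₁ x))) = ι₃ (ι₂ (ι₁ x)) :=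
      fun τ ↦ by rw [W'.conjH1_of_mem_holds p (comapResGal L U) (hH τ), AddMonoidHom.id_apply]
    constructor
    · -- Kummer at every `w ∣ u` ⟹ classical at `u` for every conjugate
      intro hx σ
      rw [hΦ]
      refine conjH1_subgroupH1Iso_mem_localKerOver_adicCompletion W p L hU u (ι₃ (ι₂ (ι₁ x))) ?_ σ
      intro w hw τ
      rw [hconj]
      exact (hsame w).mp (hx w hw)
    · -- classical at `u` for every conjugate ⟹ Kummer at every `w ∣ u`
      intro hσ w hw
      haveI := hw
      rw [hsame w, WeierstrassCurve.localKerOver_eq_ofEmb]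
      -- the `K → L` package for the `L`-embedding `closureEmb L_w`
      obtain ⟨ι, ι₂', hcompat, hf, hfixL⟩ :=
        exists_package_adicCompletion_of_embedding L u (RingEquiv.refl _) (fun _ ↦ rfl) w
          (closureEmb (K := L) (w.adicCompletion L))
      rw [← subgroupH1Iso_mem_localKerOverOfEmb_iff L ι ι₂' (closureEmb (K := L) (w.adicCompletion L)) hcompat
        ((adicCompletionMap (K := K) L u w).comp (RingEquiv.refl (u.adicCompletion K)).symm.toRingHom)
        hf W p hU (fun h hh ↦ hfixL h (hU hh)) (ι₃ (ι₂ (ι₁ x)))]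
      obtain ⟨τ, rfl⟩ := exists_algHom_eq_comp (closureEmb (K := K) (u.adicCompletion K)) ι
      rw [WeierstrassCurve.localKerOverOfEmb_comp, AddSubgroup.mem_comap, ← WeierstrassCurve.localKerOver_eq_ofEmb]
      have h := hσ τ
      rw [hΦ] at h
      exact h

end Transport

end Summit.BirchSwinnertonDyer.BirchSwinnertonDyer.Theorems.UniversalToricDescentRelaxedLayerTransport

end
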